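import Summits.BirchSwinnertonDyer.BirchSwinnertonDyer.Theorems.CMKolyvaginAtInertTwoHabitatBSDTwoOfOneBitKCAndPrimeTwistSupply
import HarnessLib

/-! Scratch (bsd-line-cmk2-p1 g22): TURNKEY deciding theorem for the NEXT restatement of route CMKolyvaginAtInertTwo — KC ↦ KC¹ (one-bit
restriction of 24648, `TURNKEY_route_edit_24648_onebit.lean`) and HL′ ↦ HL‴ (the pen's universal frame `PrimeTwistSupplyAtMinusOneModFourN`,
`cmk-rev20/HLUniv_preview.lean`).  With these two cruxes, the residual 22838 and the prints, the leaf `Summit.BirchSwinnertonDyer.WAllCornerFTwo`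
follows in ONE LINE from the landed end-state theorem `KolyvaginLowerTwo.bsdp_two_onHabitat_of_oneBitKolyvaginConjecture_of_primeTwistSupply_of_
printedInputs` (p764259) — no supply / exactness / descent derivation items are needed in `closes` any more (they are theorems).  Decl texts of the two
cruxes are copied from the turnkey / preview; the other binders are the route's current items BY NAME.  Nothing is filed here; BSD is not proved. -/

namespace Scratch.CMKolyvaginAtInertTwoClosesOneBitPrimeTwist

open Summit.BirchSwinnertonDyer.BirchSwinnertonDyer.Theses.CMKolyvaginAtInertTwo
open Summit.BirchSwinnertonDyer.BirchSwinnertonDyer.Theorems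

/-- KC¹ = `CMKolyvaginConjectureAtInertTwoOneBit` (24648 + «Σ ≤ 1» after the Heegner hypothesis; text of TURNKEY_route_edit_24648_onebit.lean). -/
def CMKolyvaginConjectureAtInertTwoOneBit : Prop :=
  ∀ (W : WeierstrassCurve ℚ) [W.IsElliptic] [W.IsGloballyMinimal] [NeZero (W.conductorNorm ℤ)], W.HasCM → Literature.NumberTheory.EllipticCurves.Rank1Residual.CMInert W 2 → W.HasSurjectiveModNGaloisRep (2 : ℤ) → W.analyticRank = 1 → Odd W.tamagawaProduct → ∀ (K : Type) [Field K] [NumberField K], Literature.NumberTheory.EllipticCurves.IsImaginaryQuadratic K → Odd (NumberField.discr K) → NumberField.discr K ≠ -3 → Literature.NumberTheory.EllipticCurves.SatisfiesHeegnerHypothesis (W.conductorNorm ℤ) K → (∑ q ∈ (NumberField.discr K).natAbs.primeFactors, ((if jacobiSym W.Δ.num q = -1 then 1 else 0) + (if jacobiSym W.Δ.num q = 1 ∧ Even (W.frobeniusTrace q) then 2 else 0)) ≤ 1) → ∀ (Dt : Literature.NumberTheory.EllipticCurves.ModularForms.ModularParametrizationData W (W.conductorNorm ℤ)), (∀ z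 ∈ Dt.L.lattice, ∃ w ∈ Literature.NumberTheory.EllipticCurves.ModularForms.periodLattice Dt.f, z = (Dt.c : ℂ) * w) → Odd Dt.c → ∀ (β : ℤ) (ι : K →+* ℂ) (d₁ : Literature.NumberTheory.EllipticCurves.KolyvaginHeegnerData Dt β ι 1), ¬ IsOfFinAddOrder d₁.derivedPoint → ∃ (n : ℕ) (d : Literature.NumberTheory.EllipticCurves.KolyvaginHeegnerData Dt β ι n), Squarefree n ∧ (∀ ℓ ∈ n.primeFactors, (Literature.NumberTheory.EllipticCurves.Zhang2014.IsKolyvaginPrime (W.conductorNorm ℤ) W K 2 ℓ ∧ Literature.NumberTheory.EllipticCurves.Rank1Residual.CMInert W ℓ)) ∧ ¬ ∃ Q : (W.baseChange (Literature.NumberTheory.EllipticCurves.ringClassField K ι n)).toAffine.Point, (2 : ℤ) • Q = d.derivedPoint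

/-- HL‴ = `PrimeTwistSupplyAtMinusOneModFourN` (text of the pen's HLUniv_preview.lean). -/
def PrimeTwistSupplyAtMinusOneModFourN : Prop :=
  ∀ (W : WeierstrassCurve ℚ) [W.IsElliptic] [W.IsGloballyMinimal] [NeZero (W.conductorNorm ℤ)],
    W.HasCM → Literature.NumberTheory.EllipticCurves.Rank1Residual.CMInert W 2 → W.HasSurjectiveModNGaloisRep (2 : ℤ) → W.analyticRank = 1 →
    ∃ p : ℕ, p.Prime ∧ (4 * W.conductorNorm ℤ : ℕ) ∣ p + 1 ∧
      (W.quadraticTwist (-(p : ℚ))).entireLFunction 1 ≠ 0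

/-- **THE DECIDING THEOREM RE-CERTIFIED for KC¹ + HL‴**: the leaf `WAllCornerFTwo` from the two cruxes, the residual, Gross 3.7 (2) and the
five prints (current item names), in one line from p764259.  All binders used. -/
theorem closes_onebitKC_primeTwist (hKC : CMKolyvaginConjectureAtInertTwoOneBit) (hHL : PrimeTwistSupplyAtMinusOneModFourN)
    (hmod : ModularityExistsNewform) (h37 : Prop37ReductionCongruenceInertAll) (hR : OffHabitatCMResidualAtTwo) (hBF : CMRankZeroBSDTriple)
    (hGZ : GrossZagierAllLevels) (hGZK : MultPublishedInputsAtTwo) (hMi : MilneAnyModel) :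
    Summit.BirchSwinnertonDyer.WAllCornerFTwo := by
  intro W _ _ hcm hr
  haveI : NeZero (W.conductorNorm ℤ) := ⟨(W.conductorNorm_pos_holds).ne'⟩
  by_cases hH : (Literature.NumberTheory.EllipticCurves.Rank1Residual.CMInert W 2 ∧ W.HasSurjectiveModNGaloisRep (2 : ℤ) ∧
        Odd W.tamagawaProduct ∧
        ∃ Dt : Literature.NumberTheory.EllipticCurves.ModularForms.ModularParametrizationData W (W.conductorNorm ℤ),
          (∀ z ∈ Dt.L.lattice, ∃ w ∈ Literature.NumberTheory.EllipticCurves.ModularForms.periodLattice Dt.f, z = (Dt.c : ℂ) * w) ∧ Odd Dt.c)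
  · obtain ⟨hin, hρ, hT, hopt⟩ := hH
    exact KolyvaginLowerTwo.bsdp_two_onHabitat_of_oneBitKolyvaginConjecture_of_primeTwistSupply_of_printedInputs hGZ hGZK hmod hMi hBF
      (fun W _ _ K _ _ ↦ h37 W K) hKC hHL W hcm hin hρ hr hT hopt
  · exact hR W hcm hr hH

end Scratch.CMKolyvaginAtInertTwoClosesOneBitPrimeTwist
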